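import Literature.NumberTheory.GaloisRepresentations.LocalWeilDatumAssembly
import Literature.NumberTheory.GaloisRepresentations.LocalWeilDatumExtensionValuation
import Literature.NumberTheory.GaloisRepresentations.LocalWeilDatumExtensionGalois
import Literature.NumberTheory.GaloisRepresentations.LocalWeilDatumRelative
import Literature.NumberTheory.GaloisRepresentations.LocalClassFieldAxiom
import Literature.NumberTheory.GaloisRepresentations.LocalCFTFromReciprocitySystem
import HarnessLib

/-!
# Norm functoriality of the local reciprocity map (Serre XIII §4 Prop. 10) from the Weil datum of `F`

For a finite **separable** extension `E/F` of non-archimedean local fields this file proves the pair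
form of finite-level local class field theory, the named fact
`exists_isReciprocitySystem_normCompatible F E` of `LocalReciprocityFinite.lean`:
reciprocity systems `ω^F`, `ω^E` of `F` and `E` with `(x, L'E/E)|_L = (N_{E/F} x, L/F)`.  The main
step is done under Neukirch's class field axiom for the Weil datum of `F`
(`(localWeilDatum F).IsClassFieldTheory`); that axiom is a theorem of the tree
(`cyclicNormIndexEq_holds` of `LocalClassFieldAxiom.lean` — Neukirch V (1.1) — with
`isClassFieldTheory_of_cyclicNormIndexEq`), so the consequences at the end are unconditional except
for the separability of `E/F`.

The point (Neukirch IV (6.4)–(6.5): "`G_L`, `A_L` is again a class field theory") is that the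
reciprocity system of `E` can be **read inside the Weil datum of `F`**: with `E₀ = ι⁻¹(E) ⊆ F̄`
(`LocalWeilDatumExtension*`), `U_E = W_F ∩ G_{E₀}` is a field of the datum, `A^{U_E} = E₀ˣ ≅ Eˣ`,
its valuation `v_{U_E}` is `ord_E` (`LocalWeilDatumExtensionValuation`), its inertia is `I_E`, and
for `L'/E` finite abelian `(U_E, W_F ∩ G_{ι⁻¹L'})` is an abelian pair with `U_E/(W_F ∩ G_{ι⁻¹L'}) ≅
Gal(L'/E)` (`LocalWeilDatumExtensionGalois`).  The norm residue symbols of these pairs form a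
reciprocity system of `E` (`isReciprocitySystemE`), and the compatibility with `ω^F` is Neukirch's
norm functoriality IV (5.8) / (6.6) inside the single datum (`recMap_eq_mk_norm_of_recMap_eq`)
together with the norm dictionary `N_{U_E|W_F} = N_{E/F}`.

Main results:
* `LocalWeilDatum.recSystemE`, `LocalWeilDatum.isReciprocitySystemE`;
* `LocalWeilDatum.exists_isReciprocitySystem_normCompatible_of_isSeparable` (under the axiom);
* unconditional consequences: `LocalWeilDatum.isClassFieldTheory_localWeilDatum`,
  `LocalWeilDatum.exists_isReciprocitySystem_holds` (the single-field fact of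
  `LocalReciprocityFinite.lean`), `LocalWeilDatum.exists_isReciprocitySystem_normCompatible_of_separable`,
  `LocalWeilDatum.exists_isLocalReciprocityMap_normCompatible_of_separable`, and
  **`LocalWeilDatum.exists_isCompatible_of_charZero : exists_isCompatible F` for `F` of characteristic
  `0`** (Serre XIII §4 Prop. 10 for all finite `E/F`; in characteristic `p` only the inseparable `E/F`
  remain outside).

## References

* J.-P. Serre, *Local Fields*, GTM 67, Ch. XIII §4, Prop. 10. [SerreLocalFields1979]
* J. Neukirch, *Algebraic Number Theory*, Ch. IV §5 (5.8), §6 (6.4)–(6.6); Ch. V §1 (1.4). [NeukirchANT1999]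
-/

noncomputable section

open Field IsNonarchimedeanLocalField ValuativeRel
open scoped Pointwise Valued

namespace Literature.NumberTheory.GaloisRepresentations

namespace LocalWeilDatum

open AbstractCFT AbstractCFT.WeilDatum GaloisRepresentations.IsNonarchimedeanLocalField

section PairA0

variable (F E : Type*) [Field F] [Field E] [Algebra F E] [FiniteDimensional F E]

/-! ### The compositum `L·E ⊆ Ē` of a finite abelian `L ⊆ F̄` -/

/-- The subfield `ι(M) ⊆ Ē` over `E`, for `E₀ ≤ M ⊆ F̄`. [folklore] -/
def extField (M : IntermediateField F (AlgebraicClosure F)) (hM : embField F E ≤ M) :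
    IntermediateField E (AlgebraicClosure E) where
  carrier := {y | (absClosureEquiv F E).symm y ∈ M}
  mul_mem' {a b} ha hb := by
    change (absClosureEquiv F E).symm (a * b) ∈ M
    rw [map_mul]
    exact M.mul_mem ha hb
  one_mem' := by
    change (absClosureEquiv F E).symm 1 ∈ M
    rw [map_one]
    exact M.one_mem
  add_mem' {a b} ha hb := by
    change (absClosureEquiv F E).symm (a + b) ∈ M
    rw [map_add]
    exact M.add_mem ha hb
  zero_mem' := by
    change (absClosureEquiv F E).symm 0 ∈ M
    rw [map_zero]
    exact M.zero_mem
  algebraMap_mem' x := by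
    change (absClosureEquiv F E).symm (algebraMap E (AlgebraicClosure E) x) ∈ M
    exact hM (toEmbField F E x).2
  inv_mem' a ha := by
    change (absClosureEquiv F E).symm a⁻¹ ∈ M
    rw [map_inv₀]
    exact M.inv_mem ha

/-- Membership in `extField M`. [folklore] -/
theorem mem_extField_iff {M : IntermediateField F (AlgebraicClosure F)} (hM : embField F E ≤ M) {y : AlgebraicClosure E} :
    y ∈ extField F E M hM ↔ (absClosureEquiv F E).symm y ∈ M :=
  Iff.rfl

/-- `ι a ∈ extField M ↔ a ∈ M`. [folklore] -/
theorem absClosureEmbedding_mem_extField_iff {M : IntermediateField F (AlgebraicClosure F)} (hM : embField F E ≤ M)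
    {a : AlgebraicClosure F} : absClosureEmbedding F E a ∈ extField F E M hM ↔ a ∈ M := by
  rw [mem_extField_iff, absClosureEquiv_symm_absClosureEmbedding]

/-- `ι⁻¹(extField M) = M`. [folklore] -/
theorem embFieldOf_extField {M : IntermediateField F (AlgebraicClosure F)} (hM : embField F E ≤ M) :
    embFieldOf F E (extField F E M hM) = M := by
  ext a
  rw [mem_embFieldOf_iff, absClosureEmbedding_mem_extField_iff]

/-- `M ≃ₐ[F] extField M` through `ι`. [folklore] -/
def equivExtField (M : IntermediateField F (AlgebraicClosure F)) (hM : embField F E ≤ M) :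
    M ≃ₐ[F] extField F E M hM :=
  AlgEquiv.ofBijective
    { toFun := fun a => ⟨absClosureEmbedding F E a, (absClosureEmbedding_mem_extField_iff F E hM).mpr a.2⟩
      map_one' := Subtype.ext (by simp)
      map_mul' := fun a b => Subtype.ext (by simp)
      map_zero' := Subtype.ext (by simp)
      map_add' := fun a b => Subtype.ext (by simp)
      commutes' := fun r => Subtype.ext (by
        change absClosureEmbedding F E (algebraMap F (AlgebraicClosure F) r) = algebraMap F (AlgebraicClosure E) r
        rw [AlgHom.commutes]) }
    ⟨fun a b h => Subtype.ext ((absClosureEmbedding_bijective F E).1 (congrArg Subtype.val h)),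
      fun y => ⟨⟨(absClosureEquiv F E).symm y, y.2⟩, Subtype.ext (absClosureEmbedding_absClosureEquiv_symm F E _)⟩⟩

/-- `extField M` is finite over `E` when `M/F` is finite. [folklore] -/
theorem finiteDimensional_extField (M : IntermediateField F (AlgebraicClosure F)) (hM : embField F E ≤ M)
    [FiniteDimensional F M] : FiniteDimensional E (extField F E M hM) := by
  haveI : FiniteDimensional F (extField F E M hM) :=
    LinearEquiv.finiteDimensional (equivExtField F E M hM).toLinearEquiv
  exact Module.Finite.of_restrictScalars_finite F E (extField F E M hM)

/-- `ι(L) ⊆ extField (L ⊔ E₀)`. [folklore] -/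
theorem absClosureEmbedding_mem_extField_sup {L : IntermediateField F (AlgebraicClosure F)} {y : AlgebraicClosure F}
    (hy : y ∈ L) : absClosureEmbedding F E y ∈ extField F E (L ⊔ embField F E) le_sup_right :=
  (absClosureEmbedding_mem_extField_iff F E le_sup_right).mpr (le_sup_left (a := L) (b := embField F E) hy)

end PairA0

section PairA

variable {F E : Type*} [Field F] [ValuativeRel F] [TopologicalSpace F] [IsNonarchimedeanLocalField F]
  [Field E] [Algebra F E] [FiniteDimensional F E]

/-- Restrictions to `L' ≤ L''` are compatible: if `γ ∈ Γ_E` and `w ∈ U_E` agree on `L''` they agree on `L'`.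
[folklore] -/
theorem restrictNormalHom_eq_weilRestrictE_of_le {L' L'' : IntermediateField E (AlgebraicClosure E)} [Normal E L'] [Normal E L'']
    (hLL : L' ≤ L'') {γ : absoluteGaloisGroup E} {w : fieldSubgroup F (embField F E)}
    (h : AlgEquiv.restrictNormalHom L'' (absoluteGaloisGroup.toAlgEquiv E γ) = weilRestrictE F E L'' w) :
    AlgEquiv.restrictNormalHom L' (absoluteGaloisGroup.toAlgEquiv E γ) = weilRestrictE F E L' w := by
  ext x
  have := congrArg (fun g : L'' ≃ₐ[E] L'' => ((g ⟨x, hLL x.2⟩ : L'') : AlgebraicClosure E)) h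
  simp only [AlgEquiv.restrictNormalHom_apply, coe_weilRestrictE_apply] at this
  rw [AlgEquiv.restrictNormalHom_apply, coe_weilRestrictE_apply]
  exact this

/-- The lift of `w ∈ U_E` with `toAbsGalois w = res σ` is `σ`. [folklore] -/
theorem liftGal_eq_of_toAbsGalois_eq {w : WeilGroup F} (hw : w ∈ fieldSubgroup F (embField F E)) {σ : absoluteGaloisGroup E}
    (h : WeilGroup.toAbsGalois F w = absGaloisRestrict F E σ) :
    liftGal F E ((toAbsGalois_mem_galFixing_iff (F := F)).mpr hw) = σ := by
  rw [liftGal_congr F E _ (h ▸ (toAbsGalois_mem_galFixing_iff (F := F)).mpr hw) h]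
  exact liftGal_absGaloisRestrict F E σ _

end PairA

section PairA'

variable (F E : Type*) [Field F] [ValuativeRel F] [TopologicalSpace F] [IsNonarchimedeanLocalField F]
  [Field E] [Algebra F E] [FiniteDimensional F E]
  [ValuativeRel E] [TopologicalSpace E] [IsNonarchimedeanLocalField E] [ValuativeExtension F E]

variable {F E}

/-- Inertia: for `i ∈ U_E`, `i` lies in the inertia of the datum iff its lift to `Γ_E` lies in `I_E`.
[cite: SerreLocalFields1979, Ch. I §7 Prop. 22] -/
theorem liftGal_mem_absInertia_iff (i : fieldSubgroup F (embField F E)) :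
    liftGal F E ((toAbsGalois_mem_galFixing_iff (F := F)).mpr i.2) ∈ absInertia E ↔
      (i : WeilGroup F) ∈ (localWeilDatum F).inertia := by
  rw [(isLocalDatum_localWeilDatum F).mem_inertia_iff, ← absGaloisRestrict_mem_absInertia_iff F E,
    absGaloisRestrict_liftGal]

end PairA'

section PairB

variable (F E : Type*) [Field F] [ValuativeRel F] [TopologicalSpace F] [IsNonarchimedeanLocalField F]
  [Field E] [Algebra F E] [FiniteDimensional F E]
  [Algebra.IsSeparable F E]

/-! ### `Eˣ` inside `A^{U_E}` -/

/-- The element of `(F^sep)ˣ` attached to `x ∈ Eˣ`: the unit `ι⁻¹ x ∈ E₀ ⊆ F^sep`.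
[cite: NeukirchANT1999, Ch. V §1 (`A_K = K^*`)] -/
def unitE (x : Eˣ) : SepUnits F :=
  haveI := finiteDimensional_embField F E
  ((unitsEquivFixedBy F (embField_le_sepClosure F E)
    (Units.map ((equivEmbField F E : E ≃ₐ[F] embField F E) : E →* embField F E) x) :
      fixedBy (SepUnits F) (fieldSubgroup F (embField F E))) : SepUnits F)

/-- `unitE x ∈ A^{U_E}`. [folklore] -/
theorem unitE_mem (x : Eˣ) : unitE F E x ∈ fixedBy (SepUnits F) (fieldSubgroup F (embField F E)) :=
  haveI := finiteDimensional_embField F E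
  (unitsEquivFixedBy F (embField_le_sepClosure F E) _).2

/-- `unitE x` is `ι⁻¹ x` in `F̄`. [folklore] -/
theorem coe_unitE (x : Eˣ) :
    (((unitE F E x : SepUnits F) : SepClosure F) : AlgebraicClosure F) =
      ((equivEmbField F E (x : E) : embField F E) : AlgebraicClosure F) :=
  rfl

/-- `ι (unitE x) = x`. [folklore] -/
theorem absClosureEmbedding_coe_unitE (x : Eˣ) :
    absClosureEmbedding F E (((unitE F E x : SepUnits F) : SepClosure F) : AlgebraicClosure F) =
      algebraMap E (AlgebraicClosure E) (x : E) := by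
  rw [coe_unitE, absClosureEmbedding_equivEmbField]

/-- `unitE` is multiplicative. [folklore] -/
theorem unitE_mul (x y : Eˣ) : unitE F E (x * y) = unitE F E x * unitE F E y := by
  unfold unitE
  rw [map_mul, map_mul]
  rfl

/-- `unitE 1 = 1`. [folklore] -/
theorem unitE_one : unitE F E 1 = 1 := by
  unfold unitE
  rw [map_one, map_one]
  rfl

/-- Every element of `A^{U_E}` is `unitE x`. [cite: NeukirchANT1999, Ch. V §1 (`A_K = K^*`)] -/
theorem exists_unitE_eq_of_mem_fixedBy {a : SepUnits F} (ha : a ∈ fixedBy (SepUnits F) (fieldSubgroup F (embField F E))) :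
    ∃ x : Eˣ, unitE F E x = a := by
  haveI := finiteDimensional_embField F E
  set x₀ := (unitsEquivFixedBy F (embField_le_sepClosure F E)).symm ⟨a, ha⟩ with hx₀
  refine ⟨Units.map ((equivEmbField F E).symm : embField F E →* E) x₀, ?_⟩
  unfold unitE
  have : Units.map ((equivEmbField F E : E ≃ₐ[F] embField F E) : E →* embField F E)
      (Units.map ((equivEmbField F E).symm : embField F E →* E) x₀) = x₀ := by
    ext
    simp
  rw [this, hx₀, MulEquiv.apply_symm_apply]

/-! ### The abelian pair `(U_E, W_F ∩ G_{ι⁻¹ L'})` -/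

/-- `U_E = W_F ∩ G_{E₀}` is a field of the datum. [folklore] -/
theorem isField_fieldSubgroup_embField : (localWeilDatum F).IsField (fieldSubgroup F (embField F E)) :=
  ⟨embField F E, finiteDimensional_embField F E, embField_le_sepClosure F E, rfl⟩

/-- `W_F ∩ G_{ι⁻¹ L'}` is a field of the datum, for `L'/E` finite separable. [folklore] -/
theorem isField_fieldSubgroup_embFieldOf (L' : IntermediateField E (AlgebraicClosure E)) [FiniteDimensional E L']
    [Algebra.IsSeparable E L'] : (localWeilDatum F).IsField (fieldSubgroup F (embFieldOf F E L')) :=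
  ⟨embFieldOf F E L', finiteDimensional_embFieldOf F E L', embFieldOf_le_sepClosure F E L', rfl⟩

/-- **`(U_E, W_F ∩ G_{ι⁻¹L'})` is an abelian pair** of the Weil datum of `F`, for `L'/E` finite abelian.
[cite: NeukirchANT1999, Ch. IV §6, (6.4)] -/
theorem isAbelianPair_embField (L' : IntermediateField E (AlgebraicClosure E)) [FiniteDimensional E L']
    [IsAbelianGalois E L'] :
    (localWeilDatum F).IsAbelianPair (fieldSubgroup F (embField F E)) (fieldSubgroup F (embFieldOf F E L')) where
  isField_left := isField_fieldSubgroup_embField F E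
  isField_right := isField_fieldSubgroup_embFieldOf F E L'
  le := fieldSubgroup_antitone F (embField_le_embFieldOf F E L')
  commutator_mem := fun _ ha _ hb => commutator_mem_fieldSubgroup_embFieldOf F E L' ha hb

/-- **`extField (L ⊔ E₀)` is Galois over `E`** for `L/F` finite Galois: the Weil subgroup
`U_E = W_F ∩ G_{E₀}` normalises `W_F ∩ G_{L ⊔ E₀} = (W_F ∩ G_L) ∩ U_E`, so `L ⊔ E₀` is Galois over
`E₀` (`isGalois_of_le_normalizer`), transported along `(E₀, L ⊔ E₀) ≅ (E, extField)`.
[cite: NeukirchANT1999, Ch. IV §6, (6.4)] -/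
theorem isGalois_extField (L : IntermediateField F (AlgebraicClosure F)) [FiniteDimensional F L] [IsAbelianGalois F L] :
    IsGalois E (extField F E (L ⊔ embField F E) le_sup_right) := by
  haveI := finiteDimensional_embField F E
  have hLs : L ≤ sepClosure F := IsLocalDatum.le_sepClosure L
  have hMs : L ⊔ embField F E ≤ sepClosure F := sup_le hLs (embField_le_sepClosure F E)
  haveI : FiniteDimensional F (L ⊔ embField F E : IntermediateField F (AlgebraicClosure F)) := inferInstance
  have hKL : embField F E ≤ L ⊔ embField F E := le_sup_right
  -- `U_E` normalises `V_L ⊓ U_E`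
  have hUn : fieldSubgroup F (embField F E) ≤
      Subgroup.normalizer ((fieldSubgroup F (L ⊔ embField F E) : Subgroup (WeilGroup F)) : Set (WeilGroup F)) := by
    intro u hu
    rw [fieldSubgroup_sup]
    refine mem_normalizer_inf ?_ (Subgroup.le_normalizer hu)
    exact ((isLocalDatum_localWeilDatum F).isAbelianPair_top L).le_normalizer (Subgroup.mem_top u)
  letI := towerAlgebra hKL
  obtain ⟨hgal, -⟩ := isGalois_of_le_normalizer F hKL hMs hUn
  haveI := hgal
  -- transport along `(E₀, L ⊔ E₀) ≅ (E, extField)`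
  let f : embField F E ≃+* E := (equivEmbField F E).symm.toRingEquiv
  let g : (L ⊔ embField F E : IntermediateField F (AlgebraicClosure F)) ≃+* extField F E (L ⊔ embField F E) le_sup_right :=
    (equivExtField F E (L ⊔ embField F E) le_sup_right).toRingEquiv
  refine IsGalois.of_equiv_equiv (F := embField F E) (E := (L ⊔ embField F E : IntermediateField F (AlgebraicClosure F)))
    (f := f) (g := g) ?_
  ext k
  change algebraMap E (AlgebraicClosure E) ((equivEmbField F E).symm k) = absClosureEmbedding F E (k : AlgebraicClosure F)
  exact (absClosureEmbedding_coe_eq F E k).symm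

/-- **`extField (L ⊔ E₀)` is abelian over `E`** for `L/F` finite abelian: its Galois group is the
image of `U_E` (`weilRestrictE_surjective`), whose commutators lie in `W_F ∩ G_L` (the pair
`(W_F, W_F ∩ G_L)` is abelian) and in `U_E`, hence act trivially.
[cite: NeukirchANT1999, Ch. IV §6, (6.4)] -/
theorem isAbelianGalois_extField (L : IntermediateField F (AlgebraicClosure F)) [FiniteDimensional F L]
    [IsAbelianGalois F L] : IsAbelianGalois E (extField F E (L ⊔ embField F E) le_sup_right) := by
  haveI := isGalois_extField F E L
  haveI := finiteDimensional_embField F E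
  haveI : FiniteDimensional F (L ⊔ embField F E : IntermediateField F (AlgebraicClosure F)) := inferInstance
  haveI := finiteDimensional_extField F E (L ⊔ embField F E) le_sup_right
  set L'' := extField F E (L ⊔ embField F E) le_sup_right
  haveI : IsMulCommutative (L'' ≃ₐ[E] L'') := by
    refine ⟨⟨fun g₁ g₂ => ?_⟩⟩
    obtain ⟨w₁, rfl⟩ := weilRestrictE_surjective F E L'' g₁
    obtain ⟨w₂, rfl⟩ := weilRestrictE_surjective F E L'' g₂
    have hcomm : (w₁ : WeilGroup F) * w₂ * (w₁ : WeilGroup F)⁻¹ * (w₂ : WeilGroup F)⁻¹ ∈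
        fieldSubgroup F (embFieldOf F E L'') := by
      rw [embFieldOf_extField, fieldSubgroup_sup]
      refine Subgroup.mem_inf.mpr ⟨?_, ?_⟩
      · exact ((isLocalDatum_localWeilDatum F).isAbelianPair_top L).commutator_mem _ (Subgroup.mem_top _) _
          (Subgroup.mem_top _)
      · exact (fieldSubgroup F (embField F E)).mul_mem ((fieldSubgroup F (embField F E)).mul_mem
          ((fieldSubgroup F (embField F E)).mul_mem w₁.2 w₂.2) ((fieldSubgroup F (embField F E)).inv_mem w₁.2))
          ((fieldSubgroup F (embField F E)).inv_mem w₂.2)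
    have h1 := (weilRestrictE_eq_one_iff F E L'' (w₁ * w₂ * w₁⁻¹ * w₂⁻¹)).mpr hcomm
    rw [map_mul, map_mul, map_mul, map_inv, map_inv, mul_inv_eq_one, mul_inv_eq_iff_eq_mul] at h1
    exact h1
  exact { toIsGalois := inferInstance, toIsMulCommutative := inferInstance }

variable {F E}

/-! ### The reciprocity system of `E` read in the datum of `F` -/

/-- **The norm residue symbols of `E` from the Weil datum of `F`**: for `L'/E` finite abelian,
`x ↦ (x, L'/E) := ν|_{L'}` where `ν ∈ U_E = W_F ∩ G_{E₀}` is Neukirch's norm residue representative of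
`ι⁻¹ x ∈ A^{U_E}` for the abelian pair `(U_E, W_F ∩ G_{ι⁻¹L'})`, restricted to `L'` through
`Γ_E ≅ G_{E₀}` (`weilRestrictE`); trivial on non-(finite abelian) `L'`.
[cite: NeukirchANT1999, Ch. IV §6, (6.4)–(6.5); SerreLocalFields1979, Ch. XIII §4] -/
def recSystemE (hcf : (localWeilDatum F).IsClassFieldTheory) (L' : IntermediateField E (AlgebraicClosure E)) :
    Eˣ →* (L' ≃ₐ[E] L') := by
  classical
  exact if h : FiniteDimensional E L' ∧ IsAbelianGalois E L' then
    haveI := h.1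
    haveI := h.2
    { toFun := fun x => weilRestrictE F E L'
        ⟨hcf.normResidue (isAbelianPair_embField F E L') (unitE_mem F E x), hcf.normResidue_mem _ _⟩
      map_one' := by
        rw [weilRestrictE_eq_one_iff]
        change hcf.normResidue (isAbelianPair_embField F E L') (unitE_mem F E 1) ∈ _
        rw [hcf.normResidue_mem_iff]
        rw [unitE_one]
        exact (normGroup _ _).one_mem
      map_mul' := fun x y => by
        have key : ∀ {a b : SepUnits F} (ha : a ∈ fixedBy (SepUnits F) (fieldSubgroup F (embField F E)))
            (hb : b ∈ fixedBy (SepUnits F) (fieldSubgroup F (embField F E))), a = b →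
            hcf.normResidue (isAbelianPair_embField F E L') ha = hcf.normResidue (isAbelianPair_embField F E L') hb := by
          rintro a b ha hb rfl
          rfl
        rw [← map_mul, weilRestrictE_eq_iff]
        change (hcf.normResidue (isAbelianPair_embField F E L') (unitE_mem F E (x * y)))⁻¹ *
          (hcf.normResidue (isAbelianPair_embField F E L') (unitE_mem F E x) *
            hcf.normResidue (isAbelianPair_embField F E L') (unitE_mem F E y)) ∈ _
        rw [key (unitE_mem F E (x * y)) ((fixedBy (SepUnits F) _).mul_mem (unitE_mem F E x) (unitE_mem F E y))
          (unitE_mul F E x y)]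
        exact hcf.normResidue_mul_inv_mul_mem (isAbelianPair_embField F E L') (unitE_mem F E x) (unitE_mem F E y) }
  else 1

/-- Unfolding `recSystemE` at a finite abelian level. [folklore] -/
theorem recSystemE_apply (hcf : (localWeilDatum F).IsClassFieldTheory) (L' : IntermediateField E (AlgebraicClosure E))
    [FiniteDimensional E L'] [IsAbelianGalois E L'] (x : Eˣ) :
    recSystemE hcf L' x = weilRestrictE F E L'
      ⟨hcf.normResidue (isAbelianPair_embField F E L') (unitE_mem F E x), hcf.normResidue_mem _ _⟩ := by
  rw [recSystemE, dif_pos ⟨‹_›, ‹_›⟩]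
  rfl

/-- **Defining property**: `(x, L'/E) = w|_{L'} ↔ r_{U_E, V'}(w) ≡ ι⁻¹x mod N` (`w ∈ U_E`).
[cite: NeukirchANT1999, Ch. IV §6, after Thm. (6.3)] -/
theorem recSystemE_eq_weilRestrictE_iff (hcf : (localWeilDatum F).IsClassFieldTheory)
    (L' : IntermediateField E (AlgebraicClosure E)) [FiniteDimensional E L'] [IsAbelianGalois E L']
    (x : Eˣ) (w : fieldSubgroup F (embField F E)) :
    recSystemE hcf L' x = weilRestrictE F E L' w ↔
      (localWeilDatum F).recMap (fieldSubgroup F (embField F E)) (fieldSubgroup F (embFieldOf F E L')) w =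
        QuotientGroup.mk (unitE F E x) := by
  rw [recSystemE_apply, weilRestrictE_eq_iff]
  exact hcf.normResidue_inv_mul_mem_iff (isAbelianPair_embField F E L') (unitE_mem F E x) w.2

/-! ### Dictionaries for `E` -/

/-- The norm-group dictionary for `E`: `ι⁻¹ x ∈ N_{V'|U_E} A^{V'} ↔ x ∈ N_{L'/E} L'ˣ`.
[cite: NeukirchANT1999, Ch. IV §6, (6.4); Ch. V §1] -/
theorem unitE_mem_normGroup_iff (L' : IntermediateField E (AlgebraicClosure E)) [FiniteDimensional E L']
    [Algebra.IsSeparable E L'] (x : Eˣ) :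
    unitE F E x ∈ normGroup (fieldSubgroup F (embFieldOf F E L')) (fieldSubgroup F (embField F E)) ↔
      x ∈ (Units.map (Algebra.norm E : L' →* E)).range := by
  haveI := finiteDimensional_embField F E
  haveI := finiteDimensional_embFieldOf F E L'
  have hKL := embField_le_embFieldOf F E L'
  letI := towerAlgebra hKL
  -- the pair `(E₀ ≤ ι⁻¹L')` is isomorphic to `(E ≤ L')`
  let e₁ : embField F E ≃+* E := (equivEmbField F E).symm.toRingEquiv
  let e₂ : embFieldOf F E L' ≃+* L' :=
    { toFun := fun a => ⟨absClosureEmbedding F E a, a.2⟩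
      invFun := fun y => ⟨(absClosureEquiv F E).symm y, symm_mem_embFieldOf F E y.2⟩
      left_inv := fun a => Subtype.ext (absClosureEquiv_symm_absClosureEmbedding F E _)
      right_inv := fun y => Subtype.ext (absClosureEmbedding_absClosureEquiv_symm F E _)
      map_mul' := fun a b => Subtype.ext (by simp)
      map_add' := fun a b => Subtype.ext (by simp) }
  have he : (algebraMap E L').comp (e₁ : embField F E →+* E) = (e₂ : embFieldOf F E L' →+* L').comp
      (algebraMap (embField F E) (embFieldOf F E L')) := by
    ext k
    change algebraMap E (AlgebraicClosure E) ((equivEmbField F E).symm k) = absClosureEmbedding F E (k : AlgebraicClosure F)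
    exact (absClosureEmbedding_coe_eq F E k).symm
  have hnorm : ∀ y : embFieldOf F E L', Algebra.norm (embField F E) y = equivEmbField F E (Algebra.norm E (e₂ y)) := by
    intro y
    rw [Algebra.norm_eq_of_equiv_equiv e₁ e₂ he y]
    rfl
  rw [show unitE F E x = ((unitsEquivFixedBy F (embField_le_sepClosure F E)
      (Units.map ((equivEmbField F E : E ≃ₐ[F] embField F E) : E →* embField F E) x) : fixedBy _ _) : SepUnits F)
    from rfl, unitsEquivFixedBy_mem_normGroup_iff F hKL (embField_le_sepClosure F E) (embFieldOf_le_sepClosure F E L')]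
  constructor
  · rintro ⟨y, hy⟩
    have hval : Algebra.norm (embField F E) (y : embFieldOf F E L') = equivEmbField F E (x : E) := by
      have := congrArg Units.val hy
      simpa [Units.coe_map] using this
    rw [hnorm] at hval
    have h2 : Algebra.norm E (e₂ y) = x := (equivEmbField F E).injective hval
    have hy0 : e₂ y ≠ 0 := (map_ne_zero_iff e₂ e₂.injective).mpr (fun h => y.ne_zero h)
    refine ⟨Units.mk0 (e₂ y) hy0, Units.ext ?_⟩
    simpa [Units.coe_map] using h2
  · rintro ⟨y', hy'⟩
    have hval : Algebra.norm E (y' : L') = x := by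
      have := congrArg Units.val hy'
      simpa [Units.coe_map] using this
    have hy0 : e₂.symm y' ≠ 0 := (map_ne_zero_iff e₂.symm e₂.symm.injective).mpr y'.ne_zero
    refine ⟨Units.mk0 (e₂.symm y') hy0, Units.ext ?_⟩
    simp only [Units.coe_map, MonoidHom.coe_coe, Units.val_mk0]
    rw [hnorm, RingEquiv.apply_symm_apply, hval]

end PairB

section PairC

variable (F E : Type*) [Field F] [ValuativeRel F] [TopologicalSpace F] [IsNonarchimedeanLocalField F]
  [Field E] [Algebra F E] [FiniteDimensional F E]
  [Algebra.IsSeparable F E]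
  [ValuativeRel E] [TopologicalSpace E] [IsNonarchimedeanLocalField E] [ValuativeExtension F E]

variable {F E}

/-- **The valuation of the datum on `U_E` is `ord_E`**: `v_{U_E}(ι⁻¹ x) = ord_E(x)`.
[cite: NeukirchANT1999, Ch. V §1 (`v_K = (1/f_K) v ∘ N`)] -/
theorem val_unitE (x : Eˣ) :
    (localWeilDatum F).val (fieldSubgroup F (embField F E)) (unitE F E x) = ord E (x : E) := by
  haveI := finiteDimensional_embField F E
  set d := localWeilDatum F
  have hU := isField_fieldSubgroup_embField F E
  have hKs := embField_le_sepClosure F E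
  have h := d.val_eq hU (unitE_mem F E x)
  have haK : (((unitE F E x : SepUnits F) : SepClosure F) : AlgebraicClosure F) ∈ embField F E :=
    (equivEmbField F E (x : E)).2
  have hx0 : (equivEmbField F E (x : E) : embField F E) ≠ 0 := by
    rw [Ne, map_eq_zero_iff _ (equivEmbField F E).injective]
    exact x.ne_zero
  have hv : d.v (norm (fieldSubgroup F (embField F E)) ⊤ (unitE F E x)) =
      (Ideal.inertiaDeg' 𝓂[F] (primeOf F (embField F E)) : ℤ) * ord E (x : E) := by
    change vSep F _ = _
    rw [vSep_eq_ord F (norm_fieldSubgroup_top_eq_algebraMap F (embField F E) hKs haK).symm,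
      show (⟨_, haK⟩ : embField F E) = equivEmbField F E (x : E) from rfl,
      ord_norm_eq_inertiaDeg_mul_ord F E _ hx0, AlgEquiv.symm_apply_apply]
  have hfU : (d.f (fieldSubgroup F (embField F E)) : ℤ) = Ideal.inertiaDeg' 𝓂[F] (primeOf F (embField F E)) := by
    change ((AbstractCFT.inertiaDeg (degHom F) (fieldSubgroup F (embField F E)) : ℕ) : ℤ) = _
    rw [inertiaDeg_fieldSubgroup_eq F (embField F E) hKs]
  have hf0 : (d.f (fieldSubgroup F (embField F E)) : ℤ) ≠ 0 := by exact_mod_cast (d.f_pos hU).ne'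
  rw [hv, ← hfU] at h
  exact mul_left_cancel₀ hf0 h

/-- Units: `ι⁻¹ u ∈ U_{U_E}` iff `u ∈ 𝒪[E]ˣ`. [cite: NeukirchANT1999, Ch. V §1] -/
theorem unitE_mem_unitGroup_iff (u : Eˣ) :
    unitE F E u ∈ (localWeilDatum F).unitGroup (fieldSubgroup F (embField F E)) ↔
      u ∈ (valuation E).valuationSubring.unitGroup := by
  rw [(localWeilDatum F).mem_unitGroup_iff (isField_fieldSubgroup_embField F E), val_unitE,
    Valuation.mem_unitGroup_iff, ord_eq_zero_iff E u.ne_zero]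
  exact ⟨fun h => h.2, fun h => ⟨unitE_mem F E u, h⟩⟩

/-! ### `recSystemE` is a reciprocity system of `E` -/

/-- **`recSystemE` is a reciprocity system of `E`** (all of Serre's finite-level properties, read in
the Weil datum of `F`): surjectivity and kernel `N_{L'/E} L'ˣ` (6.3), compatibility (5.8), units onto
inertia and `(ϖ, L'/E) = Frob` for unramified `L'` ((5.7), (6.2)), through the dictionaries
`v_{U_E} = ord_E`, `I ∩ U_E ↔ I_E`, `N_{V'|U_E} = N_{L'/E}`.
[cite: NeukirchANT1999, Ch. IV §6, (6.3)–(6.5); Ch. V §1, Thm. (1.3), (1.4); SerreLocalFields1979, Ch. XIII §4] -/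
theorem isReciprocitySystemE (hcf : (localWeilDatum F).IsClassFieldTheory) :
    IsReciprocitySystem E (recSystemE (F := F) (E := E) hcf) where
  surjective L' _ _ := by
    intro g
    set d := localWeilDatum F
    have hab := isAbelianPair_embField F E L'
    obtain ⟨w, rfl⟩ := weilRestrictE_surjective F E L' g
    obtain ⟨a, ha, h⟩ := d.recMap_mem_range hab.isField_left hab.isField_right hab.le_normalizer w.2
    obtain ⟨x, rfl⟩ := exists_unitE_eq_of_mem_fixedBy (F := F) (E := E) ha
    exact ⟨x, (recSystemE_eq_weilRestrictE_iff hcf L' x w).mpr h⟩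
  ker_eq L' _ _ := by
    set d := localWeilDatum F
    have hab := isAbelianPair_embField F E L'
    ext x
    rw [MonoidHom.mem_ker, ← unitE_mem_normGroup_iff (F := F) L' x,
      show (1 : L' ≃ₐ[E] L') = weilRestrictE F E L' 1 from (map_one _).symm,
      recSystemE_eq_weilRestrictE_iff,
      show ((1 : fieldSubgroup F (embField F E)) : WeilGroup F) = 1 from rfl,
      d.recMap_eq_one_of_mem hab.isField_left hab.isField_right hab.le hab.le_normalizer
        (fieldSubgroup F (embFieldOf F E L')).one_mem, eq_comm, QuotientGroup.eq_one_iff]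
  compatible L' L'' _ _ _ _ hLL x γ hγ := by
    set d := localWeilDatum F
    have hab := isAbelianPair_embField F E L'
    have hab' := isAbelianPair_embField F E L''
    haveI := d.finiteIndex hab.isField_right
    haveI := d.finiteIndex hab'.isField_right
    obtain ⟨w, hw⟩ := weilRestrictE_surjective F E L'' (recSystemE hcf L'' x)
    have hγ' : AlgEquiv.restrictNormalHom L'' (absoluteGaloisGroup.toAlgEquiv E γ) = weilRestrictE F E L'' w := by
      rw [hw]; exact hγ
    have h1 := (recSystemE_eq_weilRestrictE_iff hcf L'' x w).mp hw.symm
    have h2 : d.recMap (fieldSubgroup F (embField F E)) (fieldSubgroup F (embFieldOf F E L')) w =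
        QuotientGroup.mk (unitE F E x) := by
      rw [hcf.recMap_eq_map_recMap hab.isField_left hab.isField_right hab.le hab.le_normalizer
        hab'.isField_right hab'.le hab'.le_normalizer (fieldSubgroup_antitone F (embFieldOf_mono F E hLL)) w.2, h1]
      rfl
    rw [restrictNormalHom_eq_weilRestrictE_of_le hLL hγ']
    exact ((recSystemE_eq_weilRestrictE_iff hcf L' x w).mpr h2).symm
  map_unitGroup L' _ _ := by
    set d := localWeilDatum F
    have hab := isAbelianPair_embField F E L'
    apply le_antisymm
    · rintro _ ⟨u, hu, rfl⟩
      have hu' : unitE F E u ∈ d.unitGroup (fieldSubgroup F (embField F E)) := (unitE_mem_unitGroup_iff u).mpr hu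
      obtain ⟨i, hi, hrec⟩ := hcf.exists_inertia_recMap_eq_of_unit hab hu'
      have hiU : i ∈ fieldSubgroup F (embField F E) := (Subgroup.mem_inf.mp hi).1
      refine ⟨liftGal F E ((toAbsGalois_mem_galFixing_iff (F := F)).mpr hiU),
        (liftGal_mem_absInertia_iff ⟨i, hiU⟩).mpr (Subgroup.mem_inf.mp hi).2, ?_⟩
      rw [restrictNormalHom_liftGal F E L' ⟨i, hiU⟩]
      exact ((recSystemE_eq_weilRestrictE_iff hcf L' u ⟨i, hiU⟩).mpr hrec).symm
    · rintro _ ⟨σ, hσ, rfl⟩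
      have hγI : absGaloisRestrict F E σ ∈ absInertia F := (absGaloisRestrict_mem_absInertia_iff F E σ).mpr hσ
      set i : WeilGroup F := WeilGroup.mk (absGaloisRestrict F E σ) ⟨0, isFrobPow_zero_iff_mem_absInertia.mpr hγI⟩
        with hi_def
      have hiγ : WeilGroup.toAbsGalois F i = absGaloisRestrict F E σ := by rw [hi_def, WeilGroup.toAbsGalois_mk]
      have hiU : i ∈ fieldSubgroup F (embField F E) := by
        rw [← toAbsGalois_mem_galFixing_iff, hiγ]
        exact absGaloisRestrict_mem_galFixing F E σ
      have hiI : i ∈ d.inertia := by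
        rw [(isLocalDatum_localWeilDatum F).mem_inertia_iff, hiγ]
        exact hγI
      obtain ⟨a, ha, hrec⟩ := hcf.exists_unit_recMap_eq_of_mem_inertia hab (Subgroup.mem_inf.mpr ⟨hiU, hiI⟩)
      obtain ⟨u, rfl⟩ := exists_unitE_eq_of_mem_fixedBy (F := F) (E := E) (d.unitGroup_le_fixedBy hab.isField_left ha)
      refine ⟨u, (unitE_mem_unitGroup_iff u).mp ha, ?_⟩
      rw [(recSystemE_eq_weilRestrictE_iff hcf L' u ⟨i, hiU⟩).mpr hrec, weilRestrictE_apply,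
        liftGal_eq_of_toAbsGalois_eq hiU hiγ]
      rfl
  unramified_uniformizer L' _ _ hL ϖ hϖ φ hφ := by
    set d := localWeilDatum F
    haveI := finiteDimensional_embField F E
    have hab := isAbelianPair_embField F E L'
    have hU := hab.isField_left
    have hV := hab.isField_right
    have hKs := embField_le_sepClosure F E
    -- the pair `(U_E, V')` is unramified
    have hunr : d.IsUnramified (fieldSubgroup F (embFieldOf F E L')) (fieldSubgroup F (embField F E)) := by
      intro i hi
      have hiU : i ∈ fieldSubgroup F (embField F E) := (Subgroup.mem_inf.mp hi).1
      have hiI := (liftGal_mem_absInertia_iff ⟨i, hiU⟩).mpr (Subgroup.mem_inf.mp hi).2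
      apply (weilRestrictE_eq_one_iff F E L' ⟨i, hiU⟩).mp
      ext y
      rw [coe_weilRestrictE_apply, AlgEquiv.one_apply]
      exact hL _ hiI y
    -- the Frobenius `φ` of `E` restricts to an element of `U_E` of degree `f(E/F) = f_{U_E}`
    set f₀ := Ideal.inertiaDeg' 𝓂[F] (primeOf F (embField F E)) with hf₀
    have hqf : residueFieldCard E = residueFieldCard F ^ f₀ := residueFieldCard_eq_pow_inertiaDeg F E
    have hφ1 : IsFrobPow φ 1 := IsAbsArithFrob.isFrobPow_holds hφ
    have hφf : IsFrobPow (absGaloisRestrict F E φ) (f₀ : ℤ) := by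
      have := IsFrobPow.absGaloisRestrict_holds F hφ1 f₀ hqf
      rwa [mul_one] at this
    set w : WeilGroup F := WeilGroup.mk (absGaloisRestrict F E φ) ⟨f₀, hφf⟩ with hw_def
    have hwγ : WeilGroup.toAbsGalois F w = absGaloisRestrict F E φ := by rw [hw_def, WeilGroup.toAbsGalois_mk]
    have hwU : w ∈ fieldSubgroup F (embField F E) := by
      rw [← toAbsGalois_mem_galFixing_iff, hwγ]
      exact absGaloisRestrict_mem_galFixing F E φ
    have hdeg : d.degZ w = d.f (fieldSubgroup F (embField F E)) := by
      rw [degZ_localWeilDatum, show d.f (fieldSubgroup F (embField F E)) =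
        AbstractCFT.inertiaDeg (degHom F) (fieldSubgroup F (embField F E)) from rfl,
        inertiaDeg_fieldSubgroup_eq F (embField F E) hKs]
      exact (WeilGroup.deg_eq_iff IsFrobPow.mul_holds IsFrobPow.unique_holds).mpr (by rw [hwγ]; exact hφf)
    have hπ : unitE F E ϖ ∈ fixedBy (SepUnits F) (fieldSubgroup F (embField F E)) := unitE_mem F E ϖ
    have hvπ : d.val (fieldSubgroup F (embField F E)) (unitE F E ϖ) = 1 := by
      rw [val_unitE]
      exact (ord_eq_one_iff E ϖ.ne_zero).mpr hϖ
    have hrec := hcf.recMap_frob_eq hU hV hab.le hunr hwU hdeg hπ hvπ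
    rw [(recSystemE_eq_weilRestrictE_iff hcf L' ϖ ⟨w, hwU⟩).mpr hrec, weilRestrictE_apply,
      liftGal_eq_of_toAbsGalois_eq hwU hwγ]

/-! ### The theorem -/

variable (F E) in
/-- **Norm functoriality of the reciprocity map (Serre XIII §4 Prop. 10), finite level, from the
class field axiom for the Weil datum of `F`**: for `E/F` finite separable, the reciprocity systems
`ω^F` (`localRecSystem`) and `ω^E` (`recSystemE`, read in the datum of `F`) satisfy
`(x, L·E/E)|_L = (N_{E/F} x, L/F)`: the named fact `exists_isReciprocitySystem_normCompatible F E`.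
Proof: a representative `γ ∈ Γ_E` of `θ_E(x)` restricts on `L'' = L·E` to `ν|_{L''}` with
`r_{U_E, V''}(ν) ≡ ι⁻¹x`; by (5.8) `r_{W_F, W_F ∩ G_L}(ν) ≡ N_{U_E|W_F}(ι⁻¹ x) = N_{E/F} x`, so
`ν|_L = (N_{E/F} x, L/F)`, and `ν|_L = (res γ)|_L`.
[cite: SerreLocalFields1979, Ch. XIII §4 Prop. 10; NeukirchANT1999, Ch. IV §5 (5.8), §6 (6.4)–(6.6)] -/
theorem exists_isReciprocitySystem_normCompatible_of_isSeparable (hcf : (localWeilDatum F).IsClassFieldTheory) :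
    exists_isReciprocitySystem_normCompatible F E := by
  set d := localWeilDatum F
  have hd := isLocalDatum_localWeilDatum F
  haveI := finiteDimensional_embField F E
  have hKs := embField_le_sepClosure F E
  have hωE := isReciprocitySystemE (F := F) (E := E) hcf
  refine ⟨localRecSystem F hcf, recSystemE hcf, isReciprocitySystem hd hcf, hωE, fun x => ?_⟩
  obtain ⟨γ, hγ⟩ := hωE.reps_nonempty x
  refine ⟨γ, fun L' _ _ => (IsReciprocitySystem.mem_reps_iff hωE).mp hγ L', fun L _ _ => ?_⟩
  -- the compositum `L'' = L·E`
  haveI : FiniteDimensional F (L ⊔ embField F E : IntermediateField F (AlgebraicClosure F)) := inferInstance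
  haveI := finiteDimensional_extField F E (L ⊔ embField F E) le_sup_right
  haveI := isAbelianGalois_extField F E L
  set L'' := extField F E (L ⊔ embField F E) le_sup_right with hL''
  have hLs : L ≤ sepClosure F := IsLocalDatum.le_sepClosure L
  have hMs : L ⊔ embField F E ≤ sepClosure F := sup_le hLs hKs
  have hab := hd.isAbelianPair_top L
  have habE := isAbelianPair_embField F E L''
  -- `γ|_{L''} = (x, L''/E) = w|_{L''}` with `r_{U_E, V''}(w) ≡ ι⁻¹ x`
  have hγ'' : AlgEquiv.restrictNormalHom L'' (absoluteGaloisGroup.toAlgEquiv E γ) = recSystemE hcf L'' x :=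
    (IsReciprocitySystem.mem_reps_iff hωE).mp hγ L''
  obtain ⟨w, hw⟩ := weilRestrictE_surjective F E L'' (recSystemE hcf L'' x)
  have h1 := (recSystemE_eq_weilRestrictE_iff hcf L'' x w).mp hw.symm
  -- (5.8): `r_{W_F, W_F ∩ G_L}(w) ≡ N_{U_E|W_F}(ι⁻¹ x)`
  have hVM : fieldSubgroup F (embFieldOf F E L'') = fieldSubgroup F (L ⊔ embField F E) := by
    rw [hL'', embFieldOf_extField]
  have hV'V : fieldSubgroup F (embFieldOf F E L'') ≤ fieldSubgroup F L := by
    rw [hVM]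
    exact fieldSubgroup_antitone F le_sup_left
  have h2 := hcf.recMap_eq_mk_norm_of_recMap_eq d.isField_top hab.isField_right hab.le hab.le_normalizer
    habE.isField_left habE.isField_right habE.le habE.le_normalizer le_top hV'V w.2 h1
  -- `N_{U_E|W_F}(ι⁻¹ x) = N_{E/F} x`
  have haK : (((unitE F E x : SepUnits F) : SepClosure F) : AlgebraicClosure F) ∈ embField F E :=
    (equivEmbField F E (x : E)).2
  have h3 : norm (fieldSubgroup F (embField F E)) ⊤ (unitE F E x) = unitOf F (Units.map (Algebra.norm F : E →* F) x) := by
    apply Units.ext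
    apply Subtype.ext
    rw [norm_fieldSubgroup_top_eq_algebraMap F (embField F E) hKs haK, coe_unitOf,
      show (⟨_, haK⟩ : embField F E) = equivEmbField F E (x : E) from rfl, Algebra.norm_eq_of_algEquiv]
    rfl
  rw [h3] at h2
  have h4 : localRecSystem F hcf L (Units.map (Algebra.norm F : E →* F) x) = weilRestrict F L w :=
    (recSystem_eq_weilRestrict_iff hd hcf L _ w).mpr h2
  rw [h4]
  -- `(res γ)|_L = w|_L`: both agree with `γ` on `ι(L) ⊆ L''`
  have hagree : AlgEquiv.restrictNormalHom L'' (absoluteGaloisGroup.toAlgEquiv E γ) = weilRestrictE F E L'' w := by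
    rw [hγ'', hw]
  ext y
  rw [AlgEquiv.restrictNormalHom_apply, coe_weilRestrict_apply, ← absoluteGaloisGroup.smul_def]
  apply (absClosureEmbedding_bijective F E).1
  rw [absGaloisRestrict_apply_smul, ← liftGal_smul F E ((toAbsGalois_mem_galFixing_iff (F := F)).mpr w.2)]
  have := congrArg (fun g : L'' ≃ₐ[E] L'' => ((g ⟨absClosureEmbedding F E y, absClosureEmbedding_mem_extField_sup F E y.2⟩ :
    L'') : AlgebraicClosure E)) hagree
  simp only [AlgEquiv.restrictNormalHom_apply, coe_weilRestrictE_apply] at this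
  rw [absoluteGaloisGroup.smul_def]
  exact this

end PairC

/-! ### Consequences: the class field axiom holds, so everything above is unconditional for separable `E/F` -/

section Consequences

universe u v

variable (F : Type u) [Field F] [ValuativeRel F] [TopologicalSpace F] [IsNonarchimedeanLocalField F]

/-- **Neukirch's class field axiom holds for the Weil datum of a non-archimedean local field**
(IV (6.1) for `localWeilDatum F`): from Thm. V (1.1), `H⁰` part `cyclicNormIndexEq_holds`
(`LocalClassFieldAxiom.lean`) and `H⁻¹` part Hilbert 90 (`isClassFieldTheory_of_cyclicNormIndexEq`).
[cite: NeukirchANT1999, Ch. V §1, Thm. (1.1); Ch. IV §6, (6.1)] -/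
theorem isClassFieldTheory_localWeilDatum : (localWeilDatum F).IsClassFieldTheory :=
  isClassFieldTheory_of_cyclicNormIndexEq (isField_localWeilDatum_iff F) (cyclicNormIndexEq_holds F)

/-- **Discharge of the single-field fact `exists_isReciprocitySystem F`** of
`LocalReciprocityFinite.lean` (Serre XIII §4 Thm. 1, Prop. 8 Cor., Props. 12–13 at finite level) by
Neukirch's cohomology-free route: the general reciprocity law (IV (6.3)) for the local Weil datum.
[cite: NeukirchANT1999, Ch. V §1, Thm. (1.3); SerreLocalFields1979, Ch. XIII §4 Thm. 1] -/
theorem exists_isReciprocitySystem_holds :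
    _root_.Literature.NumberTheory.GaloisRepresentations.exists_isReciprocitySystem F :=
  exists_isReciprocitySystem_of_isClassFieldTheory F (isClassFieldTheory_localWeilDatum F)

/-- **The pair fact `exists_isReciprocitySystem_normCompatible F E` for `E/F` separable**, with no
further hypothesis (Serre XIII §4 Prop. 10 at finite level).
[cite: SerreLocalFields1979, Ch. XIII §4 Prop. 10; NeukirchANT1999, Ch. V §1, Thm. (1.4)] -/
theorem exists_isReciprocitySystem_normCompatible_of_separable
    (E : Type v) [Field E] [ValuativeRel E] [TopologicalSpace E] [IsNonarchimedeanLocalField E]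
    [Algebra F E] [FiniteDimensional F E] [ValuativeExtension F E] [Algebra.IsSeparable F E] :
    exists_isReciprocitySystem_normCompatible F E :=
  exists_isReciprocitySystem_normCompatible_of_isSeparable F E (isClassFieldTheory_localWeilDatum F)

/-- **Serre XIII §4 Prop. 10 with Thm. 1 for `E/F` separable**: the pair form
`exists_isLocalReciprocityMap_normCompatible F E` of local class field theory (reciprocity maps `θ_F`,
`θ_E` with `θ_F ∘ N_{E/F} = res ∘ θ_E`), the universal norm groups being trivial
(`universalNormSubgroup_eq_bot`, Lubin–Tate). [cite: SerreLocalFields1979, Ch. XIII §4 Thm. 1, Prop. 10] -/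
theorem exists_isLocalReciprocityMap_normCompatible_of_separable
    (E : Type v) [Field E] [ValuativeRel E] [TopologicalSpace E] [IsNonarchimedeanLocalField E]
    [Algebra F E] [FiniteDimensional F E] [ValuativeExtension F E] [Algebra.IsSeparable F E] :
    exists_isLocalReciprocityMap_normCompatible F E :=
  exists_isLocalReciprocityMap_normCompatible_of_isReciprocitySystem
    (exists_isReciprocitySystem_normCompatible_of_separable F E)
    (universalNormSubgroup_eq_bot F) (universalNormSubgroup_eq_bot E)

/-- **`exists_isCompatible F` for `F` of characteristic `0`** (Serre XIII §4 Prop. 10: local Artin data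
of `F` and of every finite `E/F`, compatible with the norm), unconditionally: in characteristic `0`
every finite `E/F` is separable, so `exists_isReciprocitySystem_normCompatible_of_separable` covers all
`E`, and `exists_isCompatible_of_exists_isReciprocitySystem_normCompatible`
(`LocalCFTFromReciprocitySystem.lean`) passes to the limit.  (For `F` of characteristic `p` the same
argument covers the separable `E/F`; the inseparable ones are not treated here.)
[cite: SerreLocalFields1979, Ch. XIII §4 Prop. 10; NeukirchANT1999, Ch. V §1 Thm. (1.1), (1.4)] -/
theorem exists_isCompatible_of_charZero [CharZero F] : exists_isCompatible.{u, v} F :=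
  exists_isCompatible_of_exists_isReciprocitySystem_normCompatible fun E _ _ _ _ _ _ _ =>
    haveI : Algebra.IsSeparable F E := Algebra.IsAlgebraic.isSeparable_of_perfectField
    exists_isReciprocitySystem_normCompatible_of_separable F E

end Consequences

end LocalWeilDatum

end Literature.NumberTheory.GaloisRepresentations
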